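import Summits.BirchSwinnertonDyer.BirchSwinnertonDyer.Theorems.AlignedTransportAtTwoMainConjectureOfRankZeroBSDAtTwoCubicProCyclicRowN12163
import Summits.BirchSwinnertonDyer.BirchSwinnertonDyer.Theorems.AlignedTransportAtTwoMainConjectureOfRankZeroBSDAtTwoCubicOrderFourRowN12163
import HarnessLib

/-!
# Route `AlignedTransportAtTwo`, crux C2 `MainConjectureOfRankZeroBSDAtTwo` (stmt-BirchSwinnertonDyer-22298):
# `μ₂ = 0`, `λ₂ ≤ 1`, `rank₂ Cl(K_m) ≤ 1 ∀ m` — UNCONDITIONAL — for the cyclotomic `ℤ₂`-extensions of the cubic `2`-torsion field of `⟨1, 1, 1, -4, -8⟩`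
# (`N = 12163`, the hard-core seed `t = 3`, regime (β), `e₁ = 2`): att-p3 g46's PRO-CYCLIC DOOR ∘ att-p4 g40's ORDER-FOUR CERTIFICATE

HONEST FRAMING (cell `bsd-f1-sign2`, WIDTH-5 attached prover seat `bsd-line-att-p4` gen 40 on line `birth` of the lead `bsd-line-att-p2`;
`--supports` stmt-BirchSwinnertonDyer-22298, closes nothing; BSD is NOT proved by any of this; the crux C2, its verdict «blocked-on
`Rank1Residual.GreenbergMuConjectureIrreducible`» and every registered stub are untouched).  THEOREMS ONLY (no `def`, no named fact, no instance, no `sorry`).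

WHAT.  `W = ⟨1, 1, 1, -4, -8⟩` (`Δ_min = −12163`) was the one seed of the typed u7 census on which no door could fire: `t = 3` kills the depth door, regime (β)
kills the layer-one unit door, `e₁ ≥ 2` kills the genus certificate, and the layer-two probe found `A(K₂) ≅ ℤ/8` (att-p4 g39 §2b).  att-p3 g46's PRO-CYCLIC DOOR
(`…CubicProCyclicRowN12163.classGroupPRank_le_one_cubicField_n12163`: `t = 3` decided by a residue map mod `16`, Washington §13.3 / Fukuda Thm. 1 (2) at
class-group level) displays exactly ONE hypothesis, the class-number bit `he1 : 2 ≤ classNumberPExp κ 1` (`4 ∣ h(ℚ(β,√2))`), and att-p4 g40's ORDER-FOUR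
CERTIFICATE (`…CubicOrderFourRowN12163.two_le_classNumberPExp_one_cubicField_n12163`) proves it.  Composing the two:
* ★★★ `classGroupPRank_le_one_and_mu_lambda_cubicField_n12163` — for `β` ANY root of the `2`-division cubic and EVERY cyclotomic `ℤ₂`-extension `κ` of `ℚ(β)`:
  `rank₂ Cl(K_m) ≤ 1` for all `m`, `μ₂(κ) = 0`, `λ₂(κ) ≤ 1` — NO hypothesis;
* ★★ `classicalMuVanishes_cubicField_n12163_unconditional`;
* ★ `mazurMainConjecture_two_n12163_of_print` — `MC₂(W)` modulo PRINT⁵ + MuIneqʳ + the crux's own hypotheses at `W` (`r_an = 0`, analytic `μ₂ = 0`, `BSD₂`) and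
  NOTHING ELSE (att-p3 g46's `mazurMainConjecture_two_n12163` with its class-number bit discharged).
With this file every one of the 15 typed rank-0 u7 seeds `N < 20000` with a monogenic model except `1259, 3523, 14891` (`t = 3`, `e₁ = 1`: the `μ`-question is the
layer-two datum) and `1187, 4307, 13971, 14539` (`t ≥ 4 ∧ e₁ = 2`: no door yet) has `μ₂ = 0` in the kernel.  Nothing is closed; BSD is NOT proved.

References: [Washington1997] §13.3 Prop. 13.22–13.23; [Fukuda1994] Thm. 1 (2); [Lang1990] Ch. 13 §4 Lemma 4.1; [NeukirchANT1999] I §7 (7.4); [Cohen1993] §6.5;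
[Kato2004Asterisque] Thm. 17.4; [GreenbergLNM1716] Thm. 4.1, Conj. 1.11; [LMFDB] nf 3.1.12163.1, ec 12163; tree: att-p3 g46 `…CubicProCyclicRowN12163`,
att-p4 g40 `…CubicOrderFourRowN12163{Data,Certs,}`.
-/

set_option linter.dupNamespace false
set_option autoImplicit false

noncomputable section

open scoped Classical NumberField nonZeroDivisors IntermediateField

namespace Summit.BirchSwinnertonDyer.BirchSwinnertonDyer.Theorems.AlignedTransportAtTwoCubicOrderFourRowN12163

open NumberField IsDedekindDomain Polynomial WeierstrassCurve IntermediateField CongruenceSubgroup Module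
  Literature.NumberTheory.IwasawaTheory Literature.NumberTheory.GaloisRepresentations
  Literature.NumberTheory.EllipticCurves Literature.NumberTheory.EllipticCurves.Greenberg1999
  Literature.NumberTheory.EllipticCurves.ModularForms Literature.NumberTheory.EllipticCurves.Rank1Residual
  Literature.NumberTheory.EllipticCurves.Module
  Literature.NumberTheory.NumberFields Literature.NumberTheory.CubicFields
  Summit.BirchSwinnertonDyer.Rank1Residual Summit.BirchSwinnertonDyer.Rank1Residual.X1.MuLambda
  Summit.BirchSwinnertonDyer.Rank1Residual.X5 Summit.BirchSwinnertonDyer.Rank1Residual.X5.O1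
  Summit.BirchSwinnertonDyer.Rank1Residual.X5.Instances Summit.BirchSwinnertonDyer.Rank1Residual.F1Sign2
  Summit.BirchSwinnertonDyer.BirchSwinnertonDyer.Theorems.Rank1ResidualX1Defs
  Summit.BirchSwinnertonDyer.BirchSwinnertonDyer.Theses.AlignedTransportAtTwo
  Summit.BirchSwinnertonDyer.BirchSwinnertonDyer.Theorems.AlignedTransportAtTwoCubicDoorsDeadSubcellClassNumberF
  Summit.BirchSwinnertonDyer.BirchSwinnertonDyer.Theorems.AlignedTransportAtTwoCubicProCyclicRowN12163

/-- ★★★ **`rank₂ Cl(K_m) ≤ 1 ∀ m`, `μ₂ = 0`, `λ₂ ≤ 1` — UNCONDITIONAL — for every cyclotomic `ℤ₂`-extension `κ` of the cubic `2`-torsion field `ℚ(β)` of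
`⟨1,1,1,−4,−8⟩` (discriminant `−12163`)**: att-p3 g46's pro-cyclic door row with its one displayed input `2 ≤ classNumberPExp κ 1` discharged by this seat's
order-four certificate. [cite: Washington1997, §13.3 Prop. 13.22–13.23] [cite: Fukuda1994, Thm. 1 (2), p. 264] [cite: NeukirchANT1999, Ch. I §7 Thm. (7.4)]
[cite: LMFDB, number field 3.1.12163.1 (class number 1)] -/
theorem classGroupPRank_le_one_and_mu_lambda_cubicField_n12163 {β : AlgebraicClosure ℚ}
    (hβ : aeval β ((⟨1, 1, 1, -4, -8⟩ : WeierstrassCurve ℤ).baseChange ℚ).twoTorsionPolynomial.toPoly = 0)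
    (κP : ZpExtension ↥(IntermediateField.adjoin ℚ ({β} : Set (AlgebraicClosure ℚ))) 2) (hκP : κP.IsCyclotomic) :
    (∀ m, classGroupPRank κP m ≤ 1) ∧ ClassicalMuVanishes κP ∧ classicalLambda κP ≤ 1 :=
  classGroupPRank_le_one_cubicField_n12163 hβ κP hκP (two_le_classNumberPExp_one_cubicField_n12163 hβ κP hκP)

/-- ★★ **`μ₂(κ) = 0` — UNCONDITIONAL — for every cyclotomic `ℤ₂`-extension `κ` of the cubic field of discriminant `−12163`.**
[cite: Washington1997, §13.3 Prop. 13.23] [cite: LMFDB, number field 3.1.12163.1] -/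
theorem classicalMuVanishes_cubicField_n12163_unconditional {β : AlgebraicClosure ℚ}
    (hβ : aeval β ((⟨1, 1, 1, -4, -8⟩ : WeierstrassCurve ℤ).baseChange ℚ).twoTorsionPolynomial.toPoly = 0)
    (κP : ZpExtension ↥(IntermediateField.adjoin ℚ ({β} : Set (AlgebraicClosure ℚ))) 2) (hκP : κP.IsCyclotomic) : ClassicalMuVanishes κP :=
  (classGroupPRank_le_one_and_mu_lambda_cubicField_n12163 hβ κP hκP).2.1

/-- ★ **`C2` AT THE SEED `[1, 1, 1, −4, −8]` (`N = 12163`) modulo PRINT⁵ + MuIneqʳ + the crux's own hypotheses at this `W` — the class-number bit of att-p3 g46's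
`mazurMainConjecture_two_n12163` DISCHARGED**: `MazurMainConjecture W 2` from {`h17` Kato 17.4 at `2`, `hGr` Greenberg 4.1, `hper`, `hmod`, `hGZK`} + `hI` = MuIneqʳ
(registered stub of line `birth`, verbatim) + `r_an(W) = 0`, analytic `μ₂ = 0` on the even branch, `BSD₂(W)`.  CONDITIONAL; BSD is NOT proved; nothing is closed.
[cite: Kato2004Asterisque, Thm. 17.4 (1)(2) (p. 273)] [cite: GreenbergLNM1716, Thm. 4.1 (p. 102) and Conj. 1.11 (p. 58)] [cite: Fukuda1994, Thm. 1 (2), p. 264] -/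
theorem mazurMainConjecture_two_n12163_of_print
    [((⟨1, 1, 1, -4, -8⟩ : WeierstrassCurve ℤ).baseChange ℚ).IsElliptic] [((⟨1, 1, 1, -4, -8⟩ : WeierstrassCurve ℤ).baseChange ℚ).IsGloballyMinimal]
    (h17 : ∀ [NeZero (((⟨1, 1, 1, -4, -8⟩ : WeierstrassCurve ℤ).baseChange ℚ).conductorNorm ℤ)] (f : CuspForm (Gamma0 (((⟨1, 1, 1, -4, -8⟩ : WeierstrassCurve ℤ).baseChange ℚ).conductorNorm ℤ)) 2),
      kato_divisibility_allPrimes ((⟨1, 1, 1, -4, -8⟩ : WeierstrassCurve ℤ).baseChange ℚ) 2 (f := f))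
    (hGr : Greenberg1999.thm41_charValue_rankZero_anyPrime)
    (hper : realPeriodRat_eq_unit_mul_plusPeriod_two) (hmod : nonempty_modularParametrizationData)
    (hGZK : rank_eq_analyticRank_of_analyticRank_le_one)
    (hI : ∀ (W : WeierstrassCurve ℚ) [W.IsElliptic] [W.IsGloballyMinimal], IsOrdinaryAt W 2 →
      (∀ x : ℚ, ¬ HasRationalTwoTorsionX W x) →
      ∀ (κ : ZpExtension ℚ 2) (γ : Field.absoluteGaloisGroup ℚ), κ.IsCyclotomic →
      κ.IsTopGenerator γ → IsCyclotomicVariable 2 γ →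
      ∀ ⦃N : ℕ⦄ [NeZero N] (f : CuspForm (Gamma0 N) 2), IsNewformOf W f →
      ∀ Gp : IwasawaAlgebra 2, iwasawaToPowerSeries 2 Gp = padicLFunction f (unitRoot W 2 : ℚ_[2]) →
      ∀ (D : W.SelmerDualData κ γ) (Yr : W.FineSelmerDualDataRelaxedInf κ γ),
        lengthAt (IwasawaAlgebra 2) D.X ⟨IwasawaAlgebra.augIdealP 2, IwasawaAlgebra.isPrime_augIdealP_holds 2⟩ ≤
          lengthAt (IwasawaAlgebra 2) (IwasawaAlgebra 2 ⧸ Ideal.span {Gp})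
              ⟨IwasawaAlgebra.augIdealP 2, IwasawaAlgebra.isPrime_augIdealP_holds 2⟩ +
            lengthAt (IwasawaAlgebra 2) Yr.X ⟨IwasawaAlgebra.augIdealP 2, IwasawaAlgebra.isPrime_augIdealP_holds 2⟩)
    (hr : ((⟨1, 1, 1, -4, -8⟩ : WeierstrassCurve ℤ).baseChange ℚ).analyticRank = 0)
    (hμan : ∀ ⦃N : ℕ⦄ [NeZero N] (f : CuspForm (Gamma0 N) 2), IsNewformOf ((⟨1, 1, 1, -4, -8⟩ : WeierstrassCurve ℤ).baseChange ℚ) f →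
      ∀ G : IwasawaAlgebra 2, IsEvenBranchLiftAtTwo ((⟨1, 1, 1, -4, -8⟩ : WeierstrassCurve ℤ).baseChange ℚ) f G → red G ≠ 0)
    (hbsd : BSDp ((⟨1, 1, 1, -4, -8⟩ : WeierstrassCurve ℤ).baseChange ℚ) 2) :
    MazurMainConjecture ((⟨1, 1, 1, -4, -8⟩ : WeierstrassCurve ℤ).baseChange ℚ) 2 :=
  mazurMainConjecture_two_n12163 h17 hGr hper hmod hGZK hI hr hμan hbsd
    (fun hβ κP hκP => two_le_classNumberPExp_one_cubicField_n12163 hβ κP hκP)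

end Summit.BirchSwinnertonDyer.BirchSwinnertonDyer.Theorems.AlignedTransportAtTwoCubicOrderFourRowN12163

end
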